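import Summits.HubbardSuperconductivity.HubbardSuperconductivity.Theorems.AnisotropyChordTransferFibre3RowCXSBracket
import Summits.HubbardSuperconductivity.HubbardSuperconductivity.Theorems.AnisotropyChordTransferFibre3B1EvalSound

/-!
# Route `AnisotropyChord` / H0 rotor rung, row C (KT-2b): the KERNEL-EVALUABLE cell certificate of `XSn`

`…RowCXSBracket` proves `XSn L (νθ²) ≤ xsBoundR T ν₁ ν₂ K x4hi x7hi` for every `L ≥ L₀` (`θ² ≤ T`, `K = L₀/4`) and every
`ν ∈ [ν₁, ν₂]`, given p2's cell brackets `θ⁴S₂ ≤ x4hi`, `θ⁴T10 ≤ x7hi`.  THIS FILE evaluates `xsBoundR` in exact rationals with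
PER-TERM integer rounding (denominator `D`; `⌈D·sHi(p)⌉` on the window majorant, `⌊D·(lower sums)⌋` on the subtracted window
lower sums — same `gridSum` loop as `…Fibre3B1Eval`):
* `winTQ`, `GloQ`, `GhiQ`, `mQ`, `dloQ`, `ayloQ`, `FAQ`, `FBQ`, `sHiQ`, `cTQ` (ℚ mirrors; `cast_*` lemmas);
* `inIdxX` (Boolean window-pair test), `winHiZ`, `loGm2Z`, `loGGZ` (rounded grid sums), `winPosX`;
* ★ `xsCellCheck L₀ n₁ n₂ νd Tn Td D x4hi x7hi xshi : Bool` and ★★ `xs_cell_sound`: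
  `xsCellCheck … = true` ⟹ for every `L ≥ L₀`, `ν ∈ [n₁/νd, n₂/νd]` with `θ⁴S₂ ≤ x4hi`, `θ⁴T10 ≤ x7hi`:  `XSn L (νθ²) ≤ xshi`.
With `…RowCXParseval` (`X = c_s²·XSn/(8π²) − η²ε₁`) this is the L-uniform enclosure of the phase-defect moment `X` of row C.
Prover seat `hubbard-h0-rotor-p1` g28 (route lead); helper for piece A = stmt-HubbardSuperconductivity-23918 of rung 19089
(`--supports`, helper class).  WHAT THIS IS NOT: nothing here proves superconductivity in the Hubbard model; a computable
certificate for one input of ONE row of ONE conditional reduction; the rotor TARGET as originally worded stays FALSE (g15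
verdict).  Tree imports only; no sorry, no new axioms.
-/

set_option linter.dupNamespace false
set_option autoImplicit false

open scoped BigOperators

namespace Summit.HubbardSuperconductivity.HubbardSuperconductivity.Theorems.AnisotropyChord.Transfer.Fibre3

namespace RowC

open B1

variable (L : ℕ) [NeZero L]

/-! ## Rational mirrors of the window majorant -/

/-- `W_T(q)` in `ℚ`. -/
def winTQ (T : ℚ) (q : ℤ × ℤ) : ℚ :=
  ((q.1 : ℤ) : ℚ) ^ 2 * (1 - T * ((q.1 : ℤ) : ℚ) ^ 2 / 12) + ((q.2 : ℤ) : ℚ) ^ 2 * (1 - T * ((q.2 : ℤ) : ℚ) ^ 2 / 12)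

/-- `1/(|q|² − ν₁)` in `ℚ`. -/
def GloQ (ν₁ : ℚ) (q : ℤ × ℤ) : ℚ := 1 / (((q.1 : ℤ) : ℚ) ^ 2 + ((q.2 : ℤ) : ℚ) ^ 2 - ν₁)

/-- `1/(W_T(q) − ν₂)` in `ℚ`. -/
def GhiQ (T ν₂ : ℚ) (q : ℤ × ℤ) : ℚ := 1 / (winTQ T q - ν₂)

/-- `|2p₁ − 1|` in `ℚ`. -/
def mQ (p : ℤ × ℤ) : ℚ := |2 * ((p.1 : ℤ) : ℚ) - 1|

/-- `max 0 (m(1 − Tm²/24)(1 − T/24))` in `ℚ`. -/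
def dloQ (T : ℚ) (p : ℤ × ℤ) : ℚ := max 0 (mQ p * (1 - T * mQ p ^ 2 / 24) * (1 - T / 24))

/-- `p₂²(1 − Tp₂²/12)` in `ℚ`. -/
def ayloQ (T : ℚ) (p : ℤ × ℤ) : ℚ := ((p.2 : ℤ) : ℚ) ^ 2 * (1 - T * ((p.2 : ℤ) : ℚ) ^ 2 / 12)

/-- `FAR` in `ℚ`. -/
def FAQ (T ν₁ ν₂ : ℚ) (p : ℤ × ℤ) : ℚ :=
  if 1 ≤ p.1 then max 0 (1 - dloQ T p * GloQ ν₁ p) else 1 + mQ p * GhiQ T ν₂ p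

/-- `FBR` in `ℚ`. -/
def FBQ (T ν₁ ν₂ : ℚ) (p : ℤ × ℤ) : ℚ :=
  if 0 ≤ ayloQ T p - ν₂ then -(dloQ T p ^ 2 * (ayloQ T p - ν₂) * GloQ ν₁ p ^ 2 * GloQ ν₁ (shx p) ^ 2)
  else mQ p ^ 2 * (ν₂ - ayloQ T p) * GhiQ T ν₂ p ^ 2 * GhiQ T ν₂ (shx p) ^ 2

/-- `sHiR` in `ℚ`. -/
def sHiQ (T ν₁ ν₂ : ℚ) (p : ℤ × ℤ) : ℚ := GhiQ T ν₂ (shx p) ^ 2 * FAQ T ν₁ ν₂ p + FBQ T ν₁ ν₂ p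

/-- `cT` in `ℚ`. -/
def cTQ (T ν₂ : ℚ) : ℚ := 1 + ν₂ * (1 / (1 - T / 12 - ν₂))

/-! ## The Boolean window test and the rounded grid sums -/

/-- `p ∈ idxX K` as a Boolean: `p` and `p − x̂` in the punctured window. -/
def inIdxX (K : ℕ) (p : ℤ × ℤ) : Bool := inWin K p && inWin K (shx p)

/-- `Σ_{p ∈ idxX K} ⌈D·sHi(p)⌉` (an UPPER bound of `D·Σ sHiR`). -/
def winHiZ (T ν₁ ν₂ : ℚ) (K D : ℕ) : ℤ :=
  gridSum K (fun p => if inIdxX K p then ⌈sHiQ T ν₁ ν₂ p * D⌉ else 0)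

/-- `Σ_{p ∈ idxX K} ⌊D·Glo(p − x̂)²⌋` (a LOWER bound of `D·Σ GloR(shx p)²`). -/
def loGm2Z (ν₁ : ℚ) (K D : ℕ) : ℤ :=
  gridSum K (fun p => if inIdxX K p then ⌊GloQ ν₁ (shx p) ^ 2 * D⌋ else 0)

/-- `Σ_{p ∈ idxX K} ⌊D·Glo(p)Glo(p − x̂)⌋` (a LOWER bound of `D·Σ GloR p · GloR(shx p)`). -/
def loGGZ (ν₁ : ℚ) (K D : ℕ) : ℤ :=
  gridSum K (fun p => if inIdxX K p then ⌊GloQ ν₁ p * GloQ ν₁ (shx p) * D⌋ else 0)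

/-- positivity of the two window denominators at every point of `idxX K`. -/
def winPosX (T ν₂ : ℚ) (K : ℕ) : Bool :=
  (List.range (2 * K + 1)).all fun i => (List.range (2 * K + 1)).all fun j =>
    !(inIdxX K (boxPt K i j)) || (decide (0 < winTQ T (boxPt K i j) - ν₂) && decide (0 < winTQ T (shx (boxPt K i j)) - ν₂))

/-! ## The cell certificate -/

/-- ★ THE `XSn` CELL CERTIFICATE on the `ν`-cell `[n₁/νd, n₂/νd]` at `θ₀ = 2π/L₀`, `K = L₀/4`, `T = Tn/Td ≥ (2·piHi/L₀)²`:
side conditions and the rounded evaluation of `xsBoundR ≤ xshi` (given the cell's `x4hi ≥ θ⁴S₂`, `x7hi ≥ θ⁴T10`). -/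
def xsCellCheck (L0 : ℕ) (n1 n2 νd Tn Td : ℤ) (D : ℕ) (x4hi x7hi xshi : ℚ) : Bool :=
  let K := L0 / 4
  let ν₁ : ℚ := (n1 : ℚ) / νd
  let ν₂ : ℚ := (n2 : ℚ) / νd
  let T : ℚ := (Tn : ℚ) / Td
  decide (0 < νd) && decide (0 < Td) && decide (0 ≤ n1) && decide (n1 ≤ n2) &&
  decide (ν₂ * piHi ^ 2 < 4) &&
  decide ((2 * piHi / L0) ^ 2 * Td ≤ Tn) && decide (T ≤ 1) && decide (4 ≤ L0) && decide (0 < D) &&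
  decide (0 < 1 - T / 12 - ν₂) && winPosX T ν₂ K && decide (0 < winTQ T ((1 : ℤ), (0 : ℤ)) - ν₂) &&
  decide (2 * GhiQ T ν₂ ((1 : ℤ), (0 : ℤ)) ^ 2 + (winHiZ T ν₁ ν₂ K D : ℚ) / D
      + (4 * cTQ T ν₂ ^ 2 + 2) * (x4hi - GloQ ν₁ ((-1 : ℤ), (0 : ℤ)) ^ 2 - (loGm2Z ν₁ K D : ℚ) / D)
      + 4 * cTQ T ν₂ ^ 2 * (x7hi - (loGGZ ν₁ K D : ℚ) / D) ≤ xshi)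

/-! ## Cast lemmas -/

section casts
variable (T ν₁ ν₂ : ℚ) (p q : ℤ × ℤ)

/-- `winTQ` casts to `winT`. [folklore] -/
theorem cast_winTQ : ((winTQ T q : ℚ) : ℝ) = winT (T : ℝ) q := by
  unfold winTQ winT; push_cast; ring

/-- `GloQ` casts to `GloR`. [folklore] -/
theorem cast_GloQ : ((GloQ ν₁ q : ℚ) : ℝ) = GloR (ν₁ : ℝ) q := by
  unfold GloQ GloR nsq; push_cast; ring

/-- `GhiQ` casts to `GhiR`. [folklore] -/
theorem cast_GhiQ : ((GhiQ T ν₂ q : ℚ) : ℝ) = GhiR (T : ℝ) (ν₂ : ℝ) q := by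
  unfold GhiQ GhiR; rw [← cast_winTQ]; push_cast; ring

/-- `mQ` casts to `mR`. [folklore] -/
theorem cast_mQ : ((mQ p : ℚ) : ℝ) = mR p := by
  unfold mQ mR; push_cast; ring_nf

/-- `dloQ` casts to `dloR`. [folklore] -/
theorem cast_dloQ : ((dloQ T p : ℚ) : ℝ) = dloR (T : ℝ) p := by
  unfold dloQ dloR; rw [← cast_mQ]; push_cast; ring_nf

/-- `ayloQ` casts to `ayloR`. [folklore] -/
theorem cast_ayloQ : ((ayloQ T p : ℚ) : ℝ) = ayloR (T : ℝ) p := by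
  unfold ayloQ ayloR; push_cast; ring

/-- `FAQ` casts to `FAR`. [folklore] -/
theorem cast_FAQ : ((FAQ T ν₁ ν₂ p : ℚ) : ℝ) = FAR (T : ℝ) (ν₁ : ℝ) (ν₂ : ℝ) p := by
  unfold FAQ FAR
  by_cases h : 1 ≤ p.1
  · rw [if_pos h, if_pos h, ← cast_dloQ, ← cast_GloQ]; push_cast; ring_nf
  · rw [if_neg h, if_neg h, ← cast_mQ, ← cast_GhiQ]; push_cast; ring

/-- `FBQ` casts to `FBR`. [folklore] -/
theorem cast_FBQ : ((FBQ T ν₁ ν₂ p : ℚ) : ℝ) = FBR (T : ℝ) (ν₁ : ℝ) (ν₂ : ℝ) p := by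
  unfold FBQ FBR
  have hc : (0 ≤ ayloQ T p - ν₂) ↔ (0 ≤ ayloR (T : ℝ) p - (ν₂ : ℝ)) := by
    rw [← cast_ayloQ]
    constructor
    · intro h; exact_mod_cast h
    · intro h; exact_mod_cast h
  by_cases h : 0 ≤ ayloQ T p - ν₂
  · rw [if_pos h, if_pos (hc.1 h), ← cast_dloQ, ← cast_ayloQ, ← cast_GloQ, ← cast_GloQ]; push_cast; ring
  · rw [if_neg h, if_neg (mt hc.2 h), ← cast_mQ, ← cast_ayloQ, ← cast_GhiQ, ← cast_GhiQ]; push_cast; ring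

/-- `sHiQ` casts to `sHiR`. [folklore] -/
theorem cast_sHiQ : ((sHiQ T ν₁ ν₂ p : ℚ) : ℝ) = sHiR (T : ℝ) (ν₁ : ℝ) (ν₂ : ℝ) p := by
  unfold sHiQ sHiR; rw [← cast_FAQ, ← cast_FBQ, ← cast_GhiQ]; push_cast; ring

/-- `cTQ` casts to `cT`. [folklore] -/
theorem cast_cTQ : ((cTQ T ν₂ : ℚ) : ℝ) = cT (T : ℝ) (ν₂ : ℝ) := by
  unfold cTQ cT; push_cast; ring

end casts

/-! ## The window test and the grid sums -/

/-- `inIdxX K p ↔ (p ∈ zWindow K ∧ shx p ∈ zWindow K)`. [folklore] -/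
theorem inIdxX_iff (K : ℕ) (p : ℤ × ℤ) : inIdxX K p = true ↔ (p ∈ zWindow K ∧ shx p ∈ zWindow K) := by
  unfold inIdxX
  rw [Bool.and_eq_true, inWin_iff, inWin_iff]

/-- a sum over `idxX K` as the grid loop with the Boolean test. [folklore] -/
theorem sum_idxX_eq_grid (K : ℕ) (G : ℤ × ℤ → ℝ) :
    ∑ p ∈ idxX K, G p
      = ∑ i ∈ Finset.range (2 * K + 1), ∑ j ∈ Finset.range (2 * K + 1),
          (if inIdxX K (boxPt K i j) = true then G (boxPt K i j) else 0) := by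
  classical
  unfold idxX
  rw [Finset.sum_filter, sum_box_eq_grid]
  refine Finset.sum_congr rfl fun i _ => Finset.sum_congr rfl fun j _ => ?_
  by_cases h : boxPt K i j ∈ zWindow K ∧ shx (boxPt K i j) ∈ zWindow K
  · rw [if_pos h, if_pos ((inIdxX_iff K _).2 h)]
  · rw [if_neg h, if_neg (mt (inIdxX_iff K _).1 h)]

/-- `D·Σ_{idxX} sHiR ≤ winHiZ`. [folklore] -/
theorem winHi_le_winHiZ (T ν₁ ν₂ : ℚ) (K D : ℕ) :
    (D : ℝ) * ∑ p ∈ idxX K, sHiR (T : ℝ) (ν₁ : ℝ) (ν₂ : ℝ) p ≤ ((winHiZ T ν₁ ν₂ K D : ℤ) : ℝ) := by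
  unfold winHiZ
  rw [cast_gridSum, sum_idxX_eq_grid, Finset.mul_sum]
  refine Finset.sum_le_sum fun i _ => ?_
  rw [Finset.mul_sum]
  refine Finset.sum_le_sum fun j _ => ?_
  by_cases h : inIdxX K (boxPt K i j) = true
  · rw [if_pos h]
    simp only [h, if_true]
    rw [← cast_sHiQ]
    have := Int.le_ceil (sHiQ T ν₁ ν₂ (boxPt K i j) * D)
    have h' : ((sHiQ T ν₁ ν₂ (boxPt K i j) * D : ℚ) : ℝ) ≤ ((⌈sHiQ T ν₁ ν₂ (boxPt K i j) * (D : ℚ)⌉ : ℤ) : ℝ) := by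
      exact_mod_cast this
    push_cast at h'
    linarith
  · rw [if_neg h]
    simp only [h]
    simp

/-- `loGm2Z ≤ D·Σ_{idxX} GloR(shx p)²`. [folklore] -/
theorem loGm2Z_le (ν₁ : ℚ) (K D : ℕ) :
    ((loGm2Z ν₁ K D : ℤ) : ℝ) ≤ (D : ℝ) * ∑ p ∈ idxX K, GloR (ν₁ : ℝ) (shx p) ^ 2 := by
  unfold loGm2Z
  rw [cast_gridSum, sum_idxX_eq_grid, Finset.mul_sum]
  refine Finset.sum_le_sum fun i _ => ?_
  rw [Finset.mul_sum]
  refine Finset.sum_le_sum fun j _ => ?_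
  by_cases h : inIdxX K (boxPt K i j) = true
  · rw [if_pos h]
    simp only [h, if_true]
    rw [← cast_GloQ]
    have := Int.floor_le (GloQ ν₁ (shx (boxPt K i j)) ^ 2 * D)
    have h' : ((⌊GloQ ν₁ (shx (boxPt K i j)) ^ 2 * (D : ℚ)⌋ : ℤ) : ℝ) ≤ ((GloQ ν₁ (shx (boxPt K i j)) ^ 2 * D : ℚ) : ℝ) := by
      exact_mod_cast this
    push_cast at h'
    linarith
  · rw [if_neg h]
    simp only [h]
    simp

/-- `loGGZ ≤ D·Σ_{idxX} GloR(p)·GloR(shx p)`. [folklore] -/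
theorem loGGZ_le (ν₁ : ℚ) (K D : ℕ) :
    ((loGGZ ν₁ K D : ℤ) : ℝ) ≤ (D : ℝ) * ∑ p ∈ idxX K, GloR (ν₁ : ℝ) p * GloR (ν₁ : ℝ) (shx p) := by
  unfold loGGZ
  rw [cast_gridSum, sum_idxX_eq_grid, Finset.mul_sum]
  refine Finset.sum_le_sum fun i _ => ?_
  rw [Finset.mul_sum]
  refine Finset.sum_le_sum fun j _ => ?_
  by_cases h : inIdxX K (boxPt K i j) = true
  · rw [if_pos h]
    simp only [h, if_true]
    rw [← cast_GloQ, ← cast_GloQ]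
    have := Int.floor_le (GloQ ν₁ (boxPt K i j) * GloQ ν₁ (shx (boxPt K i j)) * D)
    have h' : ((⌊GloQ ν₁ (boxPt K i j) * GloQ ν₁ (shx (boxPt K i j)) * (D : ℚ)⌋ : ℤ) : ℝ)
        ≤ ((GloQ ν₁ (boxPt K i j) * GloQ ν₁ (shx (boxPt K i j)) * D : ℚ) : ℝ) := by
      exact_mod_cast this
    push_cast at h'
    linarith
  · rw [if_neg h]
    simp only [h]
    simp

/-- `winPosX` certifies the window denominators on `idxX K`. [folklore] -/
theorem winPosX_spec (T ν₂ : ℚ) (K : ℕ) (h : winPosX T ν₂ K = true) (p : ℤ × ℤ) (hp : p ∈ idxX K) :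
    0 < winT (T : ℝ) p - (ν₂ : ℝ) ∧ 0 < winT (T : ℝ) (shx p) - (ν₂ : ℝ) := by
  unfold winPosX at h
  rw [List.all_eq_true] at h
  obtain ⟨_, hpw, hpm⟩ := Finset.mem_filter.mp hp
  have hq' := (mem_zWindow_iff K p).1 hpw
  obtain ⟨hq0, ⟨h1a, h1b⟩, ⟨h2a, h2b⟩⟩ := hq'
  have hi : (p.1 + K).toNat ∈ List.range (2 * K + 1) := by rw [List.mem_range]; omega
  have hj : (p.2 + K).toNat ∈ List.range (2 * K + 1) := by rw [List.mem_range]; omega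
  have h2 := h _ hi
  rw [List.all_eq_true] at h2
  have h3 := h2 _ hj
  have hpt : boxPt K (p.1 + K).toNat (p.2 + K).toNat = p := by
    unfold boxPt
    ext <;> simp only <;> omega
  rw [hpt, Bool.or_eq_true, Bool.not_eq_true', Bool.and_eq_true, decide_eq_true_eq, decide_eq_true_eq] at h3
  rcases h3 with h3 | ⟨h3a, h3b⟩
  · exact absurd ((inIdxX_iff K p).2 ⟨hpw, hpm⟩) (by rw [h3]; exact Bool.false_ne_true)
  · constructor
    · rw [← cast_winTQ]; exact_mod_cast h3a
    · rw [← cast_winTQ]; exact_mod_cast h3b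

/-! ## Soundness of the cell certificate -/

/-- ★★ **SOUNDNESS OF THE `XSn` CELL CERTIFICATE**: if `xsCellCheck L₀ n₁ n₂ νd Tn Td D x4hi x7hi xshi = true` then for every
`L ≥ L₀` and `ν ∈ [n₁/νd, n₂/νd]` with `θ⁴S₂ ≤ x4hi`, `θ⁴T10 ≤ x7hi`:  `XSn L (νθ²) ≤ xshi`. -/
theorem xs_cell_sound (L0 : ℕ) (n1 n2 νd Tn Td : ℤ) (D : ℕ) (x4hi x7hi xshi : ℚ)
    (h : xsCellCheck L0 n1 n2 νd Tn Td D x4hi x7hi xshi = true)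
    (L : ℕ) [NeZero L] (hL : L0 ≤ L) (ν : ℝ) (hν1 : (n1 : ℝ) / νd ≤ ν) (hν2 : ν ≤ (n2 : ℝ) / νd)
    (hx4 : ((2 * Real.pi / L) ^ 2) ^ 2 * S2n L (ν * (2 * Real.pi / L) ^ 2) ≤ ((x4hi : ℚ) : ℝ))
    (hx7 : ((2 * Real.pi / L) ^ 2) ^ 2 * T10n L (ν * (2 * Real.pi / L) ^ 2) ≤ ((x7hi : ℚ) : ℝ)) :
    XSn L (ν * (2 * Real.pi / L) ^ 2) ≤ ((xshi : ℚ) : ℝ) := by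
  unfold xsCellCheck at h
  simp only [Bool.and_eq_true, decide_eq_true_eq] at h
  obtain ⟨⟨⟨⟨⟨⟨⟨⟨⟨⟨⟨⟨hνd, hTd⟩, hn1⟩, hn12⟩, hc⟩, hT⟩, hT1⟩, hL0⟩, hD⟩, hden⟩, hpos⟩, hpos1⟩, hle⟩ := h
  have hpi := Real.pi_pos
  have hP : Real.pi ≤ ((piHi : ℚ) : ℝ) := by
    have e : ((piHi : ℚ) : ℝ) = 3.1416 := by unfold piHi; norm_num
    rw [e]
    exact Real.pi_lt_d4.le
  -- the cell endpoints
  set ν₁ : ℚ := (n1 : ℚ) / νd with hν₁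
  set ν₂ : ℚ := (n2 : ℚ) / νd with hν₂
  set T : ℚ := (Tn : ℚ) / Td with hTdef
  have hνdR : (0 : ℝ) < νd := by exact_mod_cast hνd
  have eν₁ : ((ν₁ : ℚ) : ℝ) = (n1 : ℝ) / νd := by rw [hν₁]; push_cast; ring
  have eν₂ : ((ν₂ : ℚ) : ℝ) = (n2 : ℝ) / νd := by rw [hν₂]; push_cast; ring
  have hν₁0 : (0 : ℝ) ≤ ((ν₁ : ℚ) : ℝ) := by rw [eν₁]; exact div_nonneg (by exact_mod_cast hn1) hνdR.le
  have h1 : ((ν₁ : ℚ) : ℝ) ≤ ν := by rw [eν₁]; exact hν1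
  have h2 : ν ≤ ((ν₂ : ℚ) : ℝ) := by rw [eν₂]; exact hν2
  have hcR : ((ν₂ : ℚ) : ℝ) * (((piHi : ℚ) : ℝ)) ^ 2 < 4 := by exact_mod_cast hc
  have hν2_lt : ((ν₂ : ℚ) : ℝ) < 4 / Real.pi ^ 2 := by
    rw [lt_div_iff₀ (by positivity)]
    have hν₂0 : (0 : ℝ) ≤ ((ν₂ : ℚ) : ℝ) := le_trans hν₁0 (le_trans h1 h2)
    have : Real.pi ^ 2 ≤ (((piHi : ℚ) : ℝ)) ^ 2 := pow_le_pow_left₀ hpi.le hP 2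
    nlinarith
  -- scales: `θ² ≤ T`
  have hL0pos : 0 < L0 := by omega
  have hL0R : (0 : ℝ) < L0 := by exact_mod_cast hL0pos
  have hLR : (L0 : ℝ) ≤ L := by exact_mod_cast hL
  have hLpos : (0 : ℝ) < L := lt_of_lt_of_le hL0R hLR
  have hTdR : (0 : ℝ) < Td := by exact_mod_cast hTd
  have eT : ((T : ℚ) : ℝ) = (Tn : ℝ) / Td := by rw [hTdef]; push_cast; ring
  have hθT : (2 * Real.pi / L) ^ 2 ≤ ((T : ℚ) : ℝ) := by
    rw [eT, le_div_iff₀ hTdR]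
    have h1' : (2 * Real.pi / L) ^ 2 ≤ (2 * (((piHi : ℚ) : ℝ)) / L0) ^ 2 := by
      apply pow_le_pow_left₀ (by positivity)
      calc 2 * Real.pi / L ≤ 2 * Real.pi / L0 := div_le_div_of_nonneg_left (by positivity) hL0R hLR
        _ ≤ 2 * (((piHi : ℚ) : ℝ)) / L0 := div_le_div_of_nonneg_right (by linarith) hL0R.le
    have h2' : (2 * (((piHi : ℚ) : ℝ)) / L0) ^ 2 * (Td : ℝ) ≤ Tn := by exact_mod_cast hT
    nlinarith
  have hT1R : ((T : ℚ) : ℝ) ≤ 1 := by exact_mod_cast hT1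
  have hdenR : (0 : ℝ) < 1 - ((T : ℚ) : ℝ) / 12 - ((ν₂ : ℚ) : ℝ) := by exact_mod_cast hden
  have h4K : 4 * (L0 / 4) ≤ L := le_trans (Nat.mul_div_le L0 4) hL
  have hK : 1 ≤ L0 / 4 := by omega
  have hwin := winPosX_spec T ν₂ (L0 / 4) hpos
  have hpos1R : (0 : ℝ) < winT ((T : ℚ) : ℝ) ((1 : ℤ), (0 : ℤ)) - ((ν₂ : ℚ) : ℝ) := by
    rw [← cast_winTQ]; exact_mod_cast hpos1
  -- the real bracket
  have hB := XSn_le_xsBoundR L (L0 / 4) h4K hK ((T : ℚ) : ℝ) ((ν₁ : ℚ) : ℝ) ((ν₂ : ℚ) : ℝ) ν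
    ((x4hi : ℚ) : ℝ) ((x7hi : ℚ) : ℝ) hθT hT1R hν₁0 h1 h2 hν2_lt hdenR hwin hpos1R hx4 hx7
  refine hB.trans ?_
  -- the rounded evaluation dominates `xsBoundR`
  have hDR : (0 : ℝ) < D := by exact_mod_cast hD
  have e1 := winHi_le_winHiZ T ν₁ ν₂ (L0 / 4) D
  have e2 := loGm2Z_le ν₁ (L0 / 4) D
  have e3 := loGGZ_le ν₁ (L0 / 4) D
  have hleR : 2 * ((GhiQ T ν₂ ((1 : ℤ), (0 : ℤ)) : ℚ) : ℝ) ^ 2 + ((winHiZ T ν₁ ν₂ (L0 / 4) D : ℤ) : ℝ) / D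
      + (4 * ((cTQ T ν₂ : ℚ) : ℝ) ^ 2 + 2)
          * (((x4hi : ℚ) : ℝ) - ((GloQ ν₁ ((-1 : ℤ), (0 : ℤ)) : ℚ) : ℝ) ^ 2 - ((loGm2Z ν₁ (L0 / 4) D : ℤ) : ℝ) / D)
      + 4 * ((cTQ T ν₂ : ℚ) : ℝ) ^ 2 * (((x7hi : ℚ) : ℝ) - ((loGGZ ν₁ (L0 / 4) D : ℤ) : ℝ) / D) ≤ ((xshi : ℚ) : ℝ) := by
    have := hle
    exact_mod_cast this
  rw [cast_GhiQ, cast_cTQ, cast_GloQ] at hleR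
  unfold xsBoundR
  have hc2 : (0 : ℝ) ≤ cT ((T : ℚ) : ℝ) ((ν₂ : ℚ) : ℝ) ^ 2 := sq_nonneg _
  -- compare the three rounded pieces
  have f1 : ∑ p ∈ idxX (L0 / 4), sHiR ((T : ℚ) : ℝ) ((ν₁ : ℚ) : ℝ) ((ν₂ : ℚ) : ℝ) p
      ≤ ((winHiZ T ν₁ ν₂ (L0 / 4) D : ℤ) : ℝ) / D := by
    rw [le_div_iff₀ hDR]; linarith
  have f2 : -(∑ p ∈ idxX (L0 / 4), GloR ((ν₁ : ℚ) : ℝ) (shx p) ^ 2) ≤ -(((loGm2Z ν₁ (L0 / 4) D : ℤ) : ℝ) / D) := by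
    rw [neg_le_neg_iff, div_le_iff₀ hDR]; linarith
  have f3 : -(∑ p ∈ idxX (L0 / 4), GloR ((ν₁ : ℚ) : ℝ) p * GloR ((ν₁ : ℚ) : ℝ) (shx p))
      ≤ -(((loGGZ ν₁ (L0 / 4) D : ℤ) : ℝ) / D) := by
    rw [neg_le_neg_iff, div_le_iff₀ hDR]; linarith
  have g2 := mul_le_mul_of_nonneg_left f2 (by positivity : (0 : ℝ) ≤ 4 * cT ((T : ℚ) : ℝ) ((ν₂ : ℚ) : ℝ) ^ 2 + 2)
  have g3 := mul_le_mul_of_nonneg_left f3 (by positivity : (0 : ℝ) ≤ 4 * cT ((T : ℚ) : ℝ) ((ν₂ : ℚ) : ℝ) ^ 2)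
  linarith

end RowC

end Summit.HubbardSuperconductivity.HubbardSuperconductivity.Theorems.AnisotropyChord.Transfer.Fibre3
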